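import Summits.Ventures.GridStability.Bench.DVOCGCBD19Deg2ARecertDQuotD1Pp
import Summits.Ventures.GridStability.Lyapunov.CertificateSoundness
import Summits.Ventures.GridStability.Lyapunov.PolyRecast
import Summits.Ventures.GridStability.Models.InverterDVOCInstanceD1N3
import Mathlib.Analysis.Calculus.Deriv.Pi
import Mathlib.Analysis.Normed.Module.FiniteDimension
import HarnessLib

/-!
# G3.c T3′ «DVOC3-GCBD19-D1q»-roa — from the kernel-checked quotient certificate (deg 2, toolchain
# A ≡ D, level 26573/25000) to sublevel invariance and convergence of the nine rotation invariants, and —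
# composed with model-3's transport — convergence to the rest ORBIT for every solution of the «D1»
# three-converter dVOC network MODEL M′

Venture GRIDFUSION, `plan/PARTITION.md` A20/A29 (Track T3′: «producer sos-3, A sos-1, B sos-2, Lean
sos-5, -roa lyap-1, model-side transport model-3»; lead RULING R-LOSSY-SLAB-ROW 06:46:22Z «T3′ -roa
pre-empts only if sos-5 emits T3′» — it did, 07:08Z); seat gridfusion-lyap-1 (g4). Companion of
sos-5's `Bench/DVOCGCBD19Deg2ARecertDQuotD1Pp{Data1,Data2,Data3,Psd1,}.lean` (A file of record
`cert/A/DVOC-GCBD19-deg2-A-recertD-quot-D1-pp.json`; claim instance sos-3 «D1q» `38441dad8a8ffd48`), whose decls it uses VERBATIM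
(`deg2_A_recertD_quot_D1_pp_{f_<var>, h1 … h9, V, Vdot}` — `Poly.eval` of the `_poly` literals, unfolded through their
`_eq` lemmas — and the two CERTIFIED identities `deg2_A_recertD_quot_D1_pp_{V_pos, Vdot_neg}`); the analysis is
`Lyapunov/{SublevelTrapping, CertificateSoundness, PolyRecast}.lean` (p459619 / p460300 / p482110;
generator lyap-1 `gen_t3.py`, the N = 3 twin of `Bench/DVOC2GCBD19Deg2AQ13Roa.lean` p487201); the
transport is model-3's `Models/InverterDVOCInstanceD1N3.lean` (`gcbd19n3d1.Gtilde`, `rstar`,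
`invariants₃_tendsto_of_quotient_roa`) over `Models/InverterDVOCQuotient3.lean` (p490610:
`invariants₃`, chain rule, syzygies).

SHAPE (= the hypothesis `hroa` of model-3's transport): the recast system is the SHIFTED ROTATION
QUOTIENT `ẋ = G̃(x)` of the `N = 3` dVOC network, `x = (ρ₀, ρ₁, ρ₂, ξ₀₁, ξ₀₂, ξ₁₂, ζ₀₁, ζ₀₂, ζ₁₂) − r⋆`
(`r⋆ = gcbd19n3d1.rstar`); the constraint set `M` = the shifted rank-one syzygy variety
`{h₁ = … = h₉ = 0}` ∩ the orthant conjuncts `{x_k + ρ_k⋆ ≥ 0}` (k = 0, 1, 2) of the certificate's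
domain, which the transport supplies for ALL times (`ρ_k = ‖v̂_k‖²`, the syzygies are identities of
`v̂ ↦ r`), so no first-integral argument is needed and the domain hypotheses of `Vdot_neg` are read off
`M`. Compactness of the certified piece comes from `V_pos` (`10⁻³·φ ≤ V ≤ 26573/25000` ⇒ `‖x‖∞ ≤ 33`). The
Bench field IS model-3's `G̃` (`deg2_A_recertD_quot_D1_pp_F_eq_Gtilde`, kernel identity by `ring`), and every network
state's shifted invariant vector lies in `M` (`deg2_A_recertD_quot_D1_pp_invariants_mem_M`), so the transport applies
with no hypothesis left: `deg2_A_recertD_quot_D1_pp_network_roa`.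

THREE COLUMNS. CERTIFIED (kernel, in the Bench file): on `{h = 0}`: `V ≥ 10⁻³ φ`; on
`{h = 0} ∩ {V ≤ 26573/25000} ∩ {ρ₀, ρ₁, ρ₂ ≥ 0}`: `V̇ ≤ −10⁻⁴ φ`, `φ = Σ xᵢ²`. MODELLED: every theorem of THIS
file is about the rotation-quotient ODE `ẋ = G̃(x)` of, and (last theorem) the solutions of, the
reduced-order dVOC network `InverterDVOC.DvocNetwork.gcbd19n3d1` [cite: GrossEtAl2019, §V-A eq. (17)]
= model-3's three-converter instance «D1» (`Models/InverterDVOCInstanceD1N3.lean`; instance data and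
MODEL-VALIDITY tokens as recorded there and in the Bench file's MODELLED column). VALIDATED: nothing (the synthesis SDPs are provenance of the Bench
row). No sentence of this file says a converter or a grid is stable; the network-level reading is
convergence of `(‖v̂_k‖², ⟨v̂_k, v̂_j⟩, v̂_k ∧ v̂_j)` to `r⋆`, i.e. of the network state to the rest
ORBIT of the model, for the stated initial data.
-/

namespace Summit.Ventures.GridStability.Bench.DVOCGCBD19

open Set Filter Metric Topology Real
open Summit.Ventures.GridStability.Lyapunov
open Literature.Computation.Certificates Literature.Computation.Certificates.SOS

noncomputable section

/-! ### Quotient phase space `Fin 9 → ℝ`, coordinates in the certificate's variable order ['rho_0', 'rho_1', 'rho_2', 'xi_01', 'xi_02', 'xi_12', 'zeta_01', 'zeta_02', 'zeta_12'] -/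

/-- The shifted quotient field of the instance on `Fin 9 → ℝ` (components = the Bench decls verbatim).
MODELLED column. [folklore] -/
def deg2_A_recertD_quot_D1_pp_F (z : Fin 9 → ℝ) : Fin 9 → ℝ :=
  ![deg2_A_recertD_quot_D1_pp_f_rho_0 (z 0) (z 1) (z 2) (z 3) (z 4) (z 5) (z 6) (z 7) (z 8),
    deg2_A_recertD_quot_D1_pp_f_rho_1 (z 0) (z 1) (z 2) (z 3) (z 4) (z 5) (z 6) (z 7) (z 8),
    deg2_A_recertD_quot_D1_pp_f_rho_2 (z 0) (z 1) (z 2) (z 3) (z 4) (z 5) (z 6) (z 7) (z 8),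
    deg2_A_recertD_quot_D1_pp_f_xi_01 (z 0) (z 1) (z 2) (z 3) (z 4) (z 5) (z 6) (z 7) (z 8),
    deg2_A_recertD_quot_D1_pp_f_xi_02 (z 0) (z 1) (z 2) (z 3) (z 4) (z 5) (z 6) (z 7) (z 8),
    deg2_A_recertD_quot_D1_pp_f_xi_12 (z 0) (z 1) (z 2) (z 3) (z 4) (z 5) (z 6) (z 7) (z 8),
    deg2_A_recertD_quot_D1_pp_f_zeta_01 (z 0) (z 1) (z 2) (z 3) (z 4) (z 5) (z 6) (z 7) (z 8),
    deg2_A_recertD_quot_D1_pp_f_zeta_02 (z 0) (z 1) (z 2) (z 3) (z 4) (z 5) (z 6) (z 7) (z 8),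
    deg2_A_recertD_quot_D1_pp_f_zeta_12 (z 0) (z 1) (z 2) (z 3) (z 4) (z 5) (z 6) (z 7) (z 8)]

/-- The certificate's `V` on the phase space. [folklore] -/
def deg2_A_recertD_quot_D1_pp_Vz (z : Fin 9 → ℝ) : ℝ := deg2_A_recertD_quot_D1_pp_V (z 0) (z 1) (z 2) (z 3) (z 4) (z 5) (z 6) (z 7) (z 8)

/-- Its Lie derivative `∇V·G̃` (the emitted `Vdot`). [folklore] -/
def deg2_A_recertD_quot_D1_pp_LVz (z : Fin 9 → ℝ) : ℝ := deg2_A_recertD_quot_D1_pp_Vdot (z 0) (z 1) (z 2) (z 3) (z 4) (z 5) (z 6) (z 7) (z 8)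

/-- The certified dissipation rate `W = ε_dot·φ`. [folklore] -/
def deg2_A_recertD_quot_D1_pp_Wz (z : Fin 9 → ℝ) : ℝ := ((1 : ℝ) / 10000) * ((1 : ℝ) * z 0 ^ 2 + (1 : ℝ) * z 1 ^ 2 + (1 : ℝ) * z 2 ^ 2 + (1 : ℝ) * z 3 ^ 2 + (1 : ℝ) * z 4 ^ 2 + (1 : ℝ) * z 5 ^ 2 + (1 : ℝ) * z 6 ^ 2 + (1 : ℝ) * z 7 ^ 2 + (1 : ℝ) * z 8 ^ 2)

/-- The constraint set `M` = the shifted rank-one syzygy variety `{h_1 = … = h_9 = 0}` ∩ the orthant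
conjuncts of the certificate's domain (`ρ_k = z_k + ρ_k⋆ = ‖v̂_k‖² ≥ 0` along every network solution —
supplied for ALL times by model-3's transport, so no invariance argument is needed here). [folklore] -/
def deg2_A_recertD_quot_D1_pp_M : Set (Fin 9 → ℝ) :=
  {z | deg2_A_recertD_quot_D1_pp_h1 (z 0) (z 1) (z 2) (z 3) (z 4) (z 5) (z 6) (z 7) (z 8) = 0 ∧ deg2_A_recertD_quot_D1_pp_h2 (z 0) (z 1) (z 2) (z 3) (z 4) (z 5) (z 6) (z 7) (z 8) = 0 ∧ deg2_A_recertD_quot_D1_pp_h3 (z 0) (z 1) (z 2) (z 3) (z 4) (z 5) (z 6) (z 7) (z 8) = 0 ∧ deg2_A_recertD_quot_D1_pp_h4 (z 0) (z 1) (z 2) (z 3) (z 4) (z 5) (z 6) (z 7) (z 8) = 0 ∧ deg2_A_recertD_quot_D1_pp_h5 (z 0) (z 1) (z 2) (z 3) (z 4) (z 5) (z 6) (z 7) (z 8) = 0 ∧ deg2_A_recertD_quot_D1_pp_h6 (z 0) (z 1) (z 2) (z 3) (z 4) (z 5) (z 6) (z 7) (z 8) = 0 ∧ deg2_A_recertD_quot_D1_pp_h7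 (z 0) (z 1) (z 2) (z 3) (z 4) (z 5) (z 6) (z 7) (z 8) = 0 ∧ deg2_A_recertD_quot_D1_pp_h8 (z 0) (z 1) (z 2) (z 3) (z 4) (z 5) (z 6) (z 7) (z 8) = 0 ∧ deg2_A_recertD_quot_D1_pp_h9 (z 0) (z 1) (z 2) (z 3) (z 4) (z 5) (z 6) (z 7) (z 8) = 0 ∧ 0 ≤ z 0 + (1 : ℝ) ∧ 0 ≤ z 1 + (1 : ℝ) ∧ 0 ≤ z 2 + (1 : ℝ)}

/-- The certificate's level `c = 26573/25000`. [folklore] -/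
def deg2_A_recertD_quot_D1_pp_level : ℝ := ((26573 : ℝ) / 25000)

/-- Component `0` (`rho_0`) of the quotient field. [folklore] -/
@[simp] theorem deg2_A_recertD_quot_D1_pp_F_0 (z : Fin 9 → ℝ) : deg2_A_recertD_quot_D1_pp_F z 0 = deg2_A_recertD_quot_D1_pp_f_rho_0 (z 0) (z 1) (z 2) (z 3) (z 4) (z 5) (z 6) (z 7) (z 8) := rfl
/-- Component `1` (`rho_1`) of the quotient field. [folklore] -/
@[simp] theorem deg2_A_recertD_quot_D1_pp_F_1 (z : Fin 9 → ℝ) : deg2_A_recertD_quot_D1_pp_F z 1 = deg2_A_recertD_quot_D1_pp_f_rho_1 (z 0) (z 1) (z 2) (z 3) (z 4) (z 5) (z 6) (z 7) (z 8) := rfl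
/-- Component `2` (`rho_2`) of the quotient field. [folklore] -/
@[simp] theorem deg2_A_recertD_quot_D1_pp_F_2 (z : Fin 9 → ℝ) : deg2_A_recertD_quot_D1_pp_F z 2 = deg2_A_recertD_quot_D1_pp_f_rho_2 (z 0) (z 1) (z 2) (z 3) (z 4) (z 5) (z 6) (z 7) (z 8) := rfl
/-- Component `3` (`xi_01`) of the quotient field. [folklore] -/
@[simp] theorem deg2_A_recertD_quot_D1_pp_F_3 (z : Fin 9 → ℝ) : deg2_A_recertD_quot_D1_pp_F z 3 = deg2_A_recertD_quot_D1_pp_f_xi_01 (z 0) (z 1) (z 2) (z 3) (z 4) (z 5) (z 6) (z 7) (z 8) := rfl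
/-- Component `4` (`xi_02`) of the quotient field. [folklore] -/
@[simp] theorem deg2_A_recertD_quot_D1_pp_F_4 (z : Fin 9 → ℝ) : deg2_A_recertD_quot_D1_pp_F z 4 = deg2_A_recertD_quot_D1_pp_f_xi_02 (z 0) (z 1) (z 2) (z 3) (z 4) (z 5) (z 6) (z 7) (z 8) := rfl
/-- Component `5` (`xi_12`) of the quotient field. [folklore] -/
@[simp] theorem deg2_A_recertD_quot_D1_pp_F_5 (z : Fin 9 → ℝ) : deg2_A_recertD_quot_D1_pp_F z 5 = deg2_A_recertD_quot_D1_pp_f_xi_12 (z 0) (z 1) (z 2) (z 3) (z 4) (z 5) (z 6) (z 7) (z 8) := rfl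
/-- Component `6` (`zeta_01`) of the quotient field. [folklore] -/
@[simp] theorem deg2_A_recertD_quot_D1_pp_F_6 (z : Fin 9 → ℝ) : deg2_A_recertD_quot_D1_pp_F z 6 = deg2_A_recertD_quot_D1_pp_f_zeta_01 (z 0) (z 1) (z 2) (z 3) (z 4) (z 5) (z 6) (z 7) (z 8) := rfl
/-- Component `7` (`zeta_02`) of the quotient field. [folklore] -/
@[simp] theorem deg2_A_recertD_quot_D1_pp_F_7 (z : Fin 9 → ℝ) : deg2_A_recertD_quot_D1_pp_F z 7 = deg2_A_recertD_quot_D1_pp_f_zeta_02 (z 0) (z 1) (z 2) (z 3) (z 4) (z 5) (z 6) (z 7) (z 8) := rfl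
/-- Component `8` (`zeta_12`) of the quotient field. [folklore] -/
@[simp] theorem deg2_A_recertD_quot_D1_pp_F_8 (z : Fin 9 → ℝ) : deg2_A_recertD_quot_D1_pp_F z 8 = deg2_A_recertD_quot_D1_pp_f_zeta_12 (z 0) (z 1) (z 2) (z 3) (z 4) (z 5) (z 6) (z 7) (z 8) := rfl

/-! ### Algebraic consequences of the certified identities -/

/-- Dissipation inequality in bridge form on `M ∩ {V ≤ c}`: `LV ≤ −W` (the domain hypotheses of the
Bench theorem are the orthant conjuncts of `M`). CERTIFIED input: `deg2_A_recertD_quot_D1_pp_Vdot_neg`. [folklore] -/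
theorem deg2_A_recertD_quot_D1_pp_LVz_le {z : Fin 9 → ℝ} (hz : z ∈ deg2_A_recertD_quot_D1_pp_M) (hV : deg2_A_recertD_quot_D1_pp_Vz z ≤ deg2_A_recertD_quot_D1_pp_level) :
    deg2_A_recertD_quot_D1_pp_LVz z ≤ -deg2_A_recertD_quot_D1_pp_Wz z := by
  obtain ⟨hh1, hh2, hh3, hh4, hh5, hh6, hh7, hh8, hh9, hd0, hd1, hd2⟩ := hz
  have h := deg2_A_recertD_quot_D1_pp_Vdot_neg (z 0) (z 1) (z 2) (z 3) (z 4) (z 5) (z 6) (z 7) (z 8) hV (by have hb := hd0; linarith) (by have hb := hd1; linarith) (by have hb := hd2; linarith) hh1 hh2 hh3 hh4 hh5 hh6 hh7 hh8 hh9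
  simp only [deg2_A_recertD_quot_D1_pp_LVz, deg2_A_recertD_quot_D1_pp_Wz]
  linarith

/-- `W = ε·φ` is positive definite: its only zero is the origin. [folklore] -/
theorem deg2_A_recertD_quot_D1_pp_eq_zero_of_Wz {z : Fin 9 → ℝ} (hW : deg2_A_recertD_quot_D1_pp_Wz z = 0) : z = 0 := by
  simp only [deg2_A_recertD_quot_D1_pp_Wz] at hW
  have e0 : z 0 = 0 := by
    have h : z 0 ^ 2 ≤ 0 := by linarith [sq_nonneg (z 1), sq_nonneg (z 2), sq_nonneg (z 3), sq_nonneg (z 4), sq_nonneg (z 5), sq_nonneg (z 6), sq_nonneg (z 7), sq_nonneg (z 8)]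
    exact (pow_eq_zero_iff two_ne_zero).mp (le_antisymm h (sq_nonneg _))
  have e1 : z 1 = 0 := by
    have h : z 1 ^ 2 ≤ 0 := by linarith [sq_nonneg (z 0), sq_nonneg (z 2), sq_nonneg (z 3), sq_nonneg (z 4), sq_nonneg (z 5), sq_nonneg (z 6), sq_nonneg (z 7), sq_nonneg (z 8)]
    exact (pow_eq_zero_iff two_ne_zero).mp (le_antisymm h (sq_nonneg _))
  have e2 : z 2 = 0 := by
    have h : z 2 ^ 2 ≤ 0 := by linarith [sq_nonneg (z 0), sq_nonneg (z 1), sq_nonneg (z 3), sq_nonneg (z 4), sq_nonneg (z 5), sq_nonneg (z 6), sq_nonneg (z 7), sq_nonneg (z 8)]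
    exact (pow_eq_zero_iff two_ne_zero).mp (le_antisymm h (sq_nonneg _))
  have e3 : z 3 = 0 := by
    have h : z 3 ^ 2 ≤ 0 := by linarith [sq_nonneg (z 0), sq_nonneg (z 1), sq_nonneg (z 2), sq_nonneg (z 4), sq_nonneg (z 5), sq_nonneg (z 6), sq_nonneg (z 7), sq_nonneg (z 8)]
    exact (pow_eq_zero_iff two_ne_zero).mp (le_antisymm h (sq_nonneg _))
  have e4 : z 4 = 0 := by
    have h : z 4 ^ 2 ≤ 0 := by linarith [sq_nonneg (z 0), sq_nonneg (z 1), sq_nonneg (z 2), sq_nonneg (z 3), sq_nonneg (z 5), sq_nonneg (z 6), sq_nonneg (z 7), sq_nonneg (z 8)]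
    exact (pow_eq_zero_iff two_ne_zero).mp (le_antisymm h (sq_nonneg _))
  have e5 : z 5 = 0 := by
    have h : z 5 ^ 2 ≤ 0 := by linarith [sq_nonneg (z 0), sq_nonneg (z 1), sq_nonneg (z 2), sq_nonneg (z 3), sq_nonneg (z 4), sq_nonneg (z 6), sq_nonneg (z 7), sq_nonneg (z 8)]
    exact (pow_eq_zero_iff two_ne_zero).mp (le_antisymm h (sq_nonneg _))
  have e6 : z 6 = 0 := by
    have h : z 6 ^ 2 ≤ 0 := by linarith [sq_nonneg (z 0), sq_nonneg (z 1), sq_nonneg (z 2), sq_nonneg (z 3), sq_nonneg (z 4), sq_nonneg (z 5), sq_nonneg (z 7), sq_nonneg (z 8)]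
    exact (pow_eq_zero_iff two_ne_zero).mp (le_antisymm h (sq_nonneg _))
  have e7 : z 7 = 0 := by
    have h : z 7 ^ 2 ≤ 0 := by linarith [sq_nonneg (z 0), sq_nonneg (z 1), sq_nonneg (z 2), sq_nonneg (z 3), sq_nonneg (z 4), sq_nonneg (z 5), sq_nonneg (z 6), sq_nonneg (z 8)]
    exact (pow_eq_zero_iff two_ne_zero).mp (le_antisymm h (sq_nonneg _))
  have e8 : z 8 = 0 := by
    have h : z 8 ^ 2 ≤ 0 := by linarith [sq_nonneg (z 0), sq_nonneg (z 1), sq_nonneg (z 2), sq_nonneg (z 3), sq_nonneg (z 4), sq_nonneg (z 5), sq_nonneg (z 6), sq_nonneg (z 7)]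
    exact (pow_eq_zero_iff two_ne_zero).mp (le_antisymm h (sq_nonneg _))
  funext i
  fin_cases i <;> simp [e0, e1, e2, e3, e4, e5, e6, e7, e8]

/-- Strictness on every level surface `{V = γ}`, `γ > 0`: `W > 0` there. [folklore] -/
theorem deg2_A_recertD_quot_D1_pp_Wz_pos {z : Fin 9 → ℝ} {γ : ℝ} (hγ0 : 0 < γ) (hV : deg2_A_recertD_quot_D1_pp_Vz z = γ) :
    0 < deg2_A_recertD_quot_D1_pp_Wz z := by
  have hW0 : 0 ≤ deg2_A_recertD_quot_D1_pp_Wz z := by simp only [deg2_A_recertD_quot_D1_pp_Wz]; positivity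
  rcases hW0.lt_or_eq with h | h
  · exact h
  · exfalso
    have hz0 := deg2_A_recertD_quot_D1_pp_eq_zero_of_Wz h.symm
    subst hz0
    simp [deg2_A_recertD_quot_D1_pp_Vz, deg2_A_recertD_quot_D1_pp_V_eq] at hV
    linarith

/-- `M` is closed (9 level sets and 3 closed half-spaces). [folklore] -/
theorem deg2_A_recertD_quot_D1_pp_isClosed_M : IsClosed deg2_A_recertD_quot_D1_pp_M := by
  have c0 : IsClosed {z : Fin 9 → ℝ | deg2_A_recertD_quot_D1_pp_h1 (z 0) (z 1) (z 2) (z 3) (z 4) (z 5) (z 6) (z 7) (z 8) = 0} := by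
    simp only [deg2_A_recertD_quot_D1_pp_h1_eq]
    exact isClosed_eq (by fun_prop) continuous_const
  have c1 : IsClosed {z : Fin 9 → ℝ | deg2_A_recertD_quot_D1_pp_h2 (z 0) (z 1) (z 2) (z 3) (z 4) (z 5) (z 6) (z 7) (z 8) = 0} := by
    simp only [deg2_A_recertD_quot_D1_pp_h2_eq]
    exact isClosed_eq (by fun_prop) continuous_const
  have c2 : IsClosed {z : Fin 9 → ℝ | deg2_A_recertD_quot_D1_pp_h3 (z 0) (z 1) (z 2) (z 3) (z 4) (z 5) (z 6) (z 7) (z 8) = 0} := by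
    simp only [deg2_A_recertD_quot_D1_pp_h3_eq]
    exact isClosed_eq (by fun_prop) continuous_const
  have c3 : IsClosed {z : Fin 9 → ℝ | deg2_A_recertD_quot_D1_pp_h4 (z 0) (z 1) (z 2) (z 3) (z 4) (z 5) (z 6) (z 7) (z 8) = 0} := by
    simp only [deg2_A_recertD_quot_D1_pp_h4_eq]
    exact isClosed_eq (by fun_prop) continuous_const
  have c4 : IsClosed {z : Fin 9 → ℝ | deg2_A_recertD_quot_D1_pp_h5 (z 0) (z 1) (z 2) (z 3) (z 4) (z 5) (z 6) (z 7) (z 8) = 0} := by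
    simp only [deg2_A_recertD_quot_D1_pp_h5_eq]
    exact isClosed_eq (by fun_prop) continuous_const
  have c5 : IsClosed {z : Fin 9 → ℝ | deg2_A_recertD_quot_D1_pp_h6 (z 0) (z 1) (z 2) (z 3) (z 4) (z 5) (z 6) (z 7) (z 8) = 0} := by
    simp only [deg2_A_recertD_quot_D1_pp_h6_eq]
    exact isClosed_eq (by fun_prop) continuous_const
  have c6 : IsClosed {z : Fin 9 → ℝ | deg2_A_recertD_quot_D1_pp_h7 (z 0) (z 1) (z 2) (z 3) (z 4) (z 5) (z 6) (z 7) (z 8) = 0} := by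
    simp only [deg2_A_recertD_quot_D1_pp_h7_eq]
    exact isClosed_eq (by fun_prop) continuous_const
  have c7 : IsClosed {z : Fin 9 → ℝ | deg2_A_recertD_quot_D1_pp_h8 (z 0) (z 1) (z 2) (z 3) (z 4) (z 5) (z 6) (z 7) (z 8) = 0} := by
    simp only [deg2_A_recertD_quot_D1_pp_h8_eq]
    exact isClosed_eq (by fun_prop) continuous_const
  have c8 : IsClosed {z : Fin 9 → ℝ | deg2_A_recertD_quot_D1_pp_h9 (z 0) (z 1) (z 2) (z 3) (z 4) (z 5) (z 6) (z 7) (z 8) = 0} := by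
    simp only [deg2_A_recertD_quot_D1_pp_h9_eq]
    exact isClosed_eq (by fun_prop) continuous_const
  have d0 : IsClosed {z : Fin 9 → ℝ | 0 ≤ z 0 + (1 : ℝ)} := isClosed_le continuous_const (by fun_prop)
  have d1 : IsClosed {z : Fin 9 → ℝ | 0 ≤ z 1 + (1 : ℝ)} := isClosed_le continuous_const (by fun_prop)
  have d2 : IsClosed {z : Fin 9 → ℝ | 0 ≤ z 2 + (1 : ℝ)} := isClosed_le continuous_const (by fun_prop)
  have : deg2_A_recertD_quot_D1_pp_M = {z : Fin 9 → ℝ | deg2_A_recertD_quot_D1_pp_h1 (z 0) (z 1) (z 2) (z 3) (z 4) (z 5) (z 6) (z 7) (z 8) = 0} ∩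
      ({z : Fin 9 → ℝ | deg2_A_recertD_quot_D1_pp_h2 (z 0) (z 1) (z 2) (z 3) (z 4) (z 5) (z 6) (z 7) (z 8) = 0} ∩
      ({z : Fin 9 → ℝ | deg2_A_recertD_quot_D1_pp_h3 (z 0) (z 1) (z 2) (z 3) (z 4) (z 5) (z 6) (z 7) (z 8) = 0} ∩
      ({z : Fin 9 → ℝ | deg2_A_recertD_quot_D1_pp_h4 (z 0) (z 1) (z 2) (z 3) (z 4) (z 5) (z 6) (z 7) (z 8) = 0} ∩
      ({z : Fin 9 → ℝ | deg2_A_recertD_quot_D1_pp_h5 (z 0) (z 1) (z 2) (z 3) (z 4) (z 5) (z 6) (z 7) (z 8) = 0} ∩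
      ({z : Fin 9 → ℝ | deg2_A_recertD_quot_D1_pp_h6 (z 0) (z 1) (z 2) (z 3) (z 4) (z 5) (z 6) (z 7) (z 8) = 0} ∩
      ({z : Fin 9 → ℝ | deg2_A_recertD_quot_D1_pp_h7 (z 0) (z 1) (z 2) (z 3) (z 4) (z 5) (z 6) (z 7) (z 8) = 0} ∩
      ({z : Fin 9 → ℝ | deg2_A_recertD_quot_D1_pp_h8 (z 0) (z 1) (z 2) (z 3) (z 4) (z 5) (z 6) (z 7) (z 8) = 0} ∩
      ({z : Fin 9 → ℝ | deg2_A_recertD_quot_D1_pp_h9 (z 0) (z 1) (z 2) (z 3) (z 4) (z 5) (z 6) (z 7) (z 8) = 0} ∩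
      ({z : Fin 9 → ℝ | 0 ≤ z 0 + (1 : ℝ)} ∩
      ({z : Fin 9 → ℝ | 0 ≤ z 1 + (1 : ℝ)} ∩
      ({z : Fin 9 → ℝ | 0 ≤ z 2 + (1 : ℝ)}))))))))))) := by
    ext z; simp only [deg2_A_recertD_quot_D1_pp_M, Set.mem_setOf_eq, Set.mem_inter_iff]
  rw [this]
  exact c0.inter (c1.inter (c2.inter (c3.inter (c4.inter (c5.inter (c6.inter (c7.inter (c8.inter (d0.inter (d1.inter (d2)))))))))))

/-- Compactness of the certified piece `S = {z ∈ M | V z ≤ c}` (closed; bounded by `V_pos`: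
`((1 : ℝ) / 1000)·φ ≤ V ≤ 26573/25000` ⇒ `‖z‖∞ ≤ 33`). [folklore] -/
theorem deg2_A_recertD_quot_D1_pp_isCompact_S : IsCompact {z ∈ deg2_A_recertD_quot_D1_pp_M | deg2_A_recertD_quot_D1_pp_Vz z ≤ deg2_A_recertD_quot_D1_pp_level} := by
  have hMc : IsClosed deg2_A_recertD_quot_D1_pp_M := deg2_A_recertD_quot_D1_pp_isClosed_M
  have hVc : Continuous deg2_A_recertD_quot_D1_pp_Vz := by
    unfold deg2_A_recertD_quot_D1_pp_Vz; simp only [deg2_A_recertD_quot_D1_pp_V_eq]; fun_prop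
  have h := isCompact_sublevel_of_norm_le (D := univ) (c := deg2_A_recertD_quot_D1_pp_level) (R := (33 : ℝ)) hMc
    isClosed_univ hVc.continuousOn ?_
  · rwa [inter_univ] at h
  rintro z ⟨hz, -⟩ hV
  obtain ⟨hh1, hh2, hh3, hh4, hh5, hh6, hh7, hh8, hh9, hd0, hd1, hd2⟩ := hz
  have hball := deg2_A_recertD_quot_D1_pp_V_pos (z 0) (z 1) (z 2) (z 3) (z 4) (z 5) (z 6) (z 7) (z 8) hh1 hh2 hh3 hh4 hh5 hh6 hh7 hh8 hh9
  have hlev : deg2_A_recertD_quot_D1_pp_Vz z ≤ ((26573 : ℝ) / 25000) := by simpa only [deg2_A_recertD_quot_D1_pp_level] using hV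
  simp only [deg2_A_recertD_quot_D1_pp_Vz] at hlev
  -- keep `V` opaque for the arithmetic (its body must not be unfolded by `whnf`)
  generalize deg2_A_recertD_quot_D1_pp_V (z 0) (z 1) (z 2) (z 3) (z 4) (z 5) (z 6) (z 7) (z 8) = VV at hball hlev
  have hsum : z 0 ^ 2 + z 1 ^ 2 + z 2 ^ 2 + z 3 ^ 2 + z 4 ^ 2 + z 5 ^ 2 + z 6 ^ 2 + z 7 ^ 2 + z 8 ^ 2 ≤ ((26573 : ℝ) / 25) := by
    linarith
  have hb0 : |z 0| ≤ (33 : ℝ) :=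
    abs_le.2 (abs_le_of_sq_le_sq' (by linarith [hsum, sq_nonneg (z 1), sq_nonneg (z 2), sq_nonneg (z 3), sq_nonneg (z 4), sq_nonneg (z 5), sq_nonneg (z 6), sq_nonneg (z 7), sq_nonneg (z 8)]) (by norm_num))
  have hb1 : |z 1| ≤ (33 : ℝ) :=
    abs_le.2 (abs_le_of_sq_le_sq' (by linarith [hsum, sq_nonneg (z 0), sq_nonneg (z 2), sq_nonneg (z 3), sq_nonneg (z 4), sq_nonneg (z 5), sq_nonneg (z 6), sq_nonneg (z 7), sq_nonneg (z 8)]) (by norm_num))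
  have hb2 : |z 2| ≤ (33 : ℝ) :=
    abs_le.2 (abs_le_of_sq_le_sq' (by linarith [hsum, sq_nonneg (z 0), sq_nonneg (z 1), sq_nonneg (z 3), sq_nonneg (z 4), sq_nonneg (z 5), sq_nonneg (z 6), sq_nonneg (z 7), sq_nonneg (z 8)]) (by norm_num))
  have hb3 : |z 3| ≤ (33 : ℝ) :=
    abs_le.2 (abs_le_of_sq_le_sq' (by linarith [hsum, sq_nonneg (z 0), sq_nonneg (z 1), sq_nonneg (z 2), sq_nonneg (z 4), sq_nonneg (z 5), sq_nonneg (z 6), sq_nonneg (z 7), sq_nonneg (z 8)]) (by norm_num))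
  have hb4 : |z 4| ≤ (33 : ℝ) :=
    abs_le.2 (abs_le_of_sq_le_sq' (by linarith [hsum, sq_nonneg (z 0), sq_nonneg (z 1), sq_nonneg (z 2), sq_nonneg (z 3), sq_nonneg (z 5), sq_nonneg (z 6), sq_nonneg (z 7), sq_nonneg (z 8)]) (by norm_num))
  have hb5 : |z 5| ≤ (33 : ℝ) :=
    abs_le.2 (abs_le_of_sq_le_sq' (by linarith [hsum, sq_nonneg (z 0), sq_nonneg (z 1), sq_nonneg (z 2), sq_nonneg (z 3), sq_nonneg (z 4), sq_nonneg (z 6), sq_nonneg (z 7), sq_nonneg (z 8)]) (by norm_num))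
  have hb6 : |z 6| ≤ (33 : ℝ) :=
    abs_le.2 (abs_le_of_sq_le_sq' (by linarith [hsum, sq_nonneg (z 0), sq_nonneg (z 1), sq_nonneg (z 2), sq_nonneg (z 3), sq_nonneg (z 4), sq_nonneg (z 5), sq_nonneg (z 7), sq_nonneg (z 8)]) (by norm_num))
  have hb7 : |z 7| ≤ (33 : ℝ) :=
    abs_le.2 (abs_le_of_sq_le_sq' (by linarith [hsum, sq_nonneg (z 0), sq_nonneg (z 1), sq_nonneg (z 2), sq_nonneg (z 3), sq_nonneg (z 4), sq_nonneg (z 5), sq_nonneg (z 6), sq_nonneg (z 8)]) (by norm_num))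
  have hb8 : |z 8| ≤ (33 : ℝ) :=
    abs_le.2 (abs_le_of_sq_le_sq' (by linarith [hsum, sq_nonneg (z 0), sq_nonneg (z 1), sq_nonneg (z 2), sq_nonneg (z 3), sq_nonneg (z 4), sq_nonneg (z 5), sq_nonneg (z 6), sq_nonneg (z 7)]) (by norm_num))
  refine (pi_norm_le_iff_of_nonneg (by norm_num)).2 fun i ↦ ?_
  rw [Real.norm_eq_abs]
  fin_cases i
  · simpa using hb0
  · simpa using hb1
  · simpa using hb2
  · simpa using hb3
  · simpa using hb4
  · simpa using hb5
  · simpa using hb6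
  · simpa using hb7
  · simpa using hb8

/-! ### Calculus along a solution of the quotient system (generic route: `Lyapunov/PolyRecast.lean`) -/

/-- The certificate's `Vdot` polynomial IS the kernel Lie derivative of `V` along `G̃`
(model-1's `SOS.Poly.lieDeriv`; one `decide`, term order immaterial). [folklore] -/
theorem deg2_A_recertD_quot_D1_pp_Vdot_isLieDeriv :
    Poly.isZero (Poly.add deg2_A_recertD_quot_D1_pp_Vdot_poly (Poly.neg (Poly.lieDeriv [deg2_A_recertD_quot_D1_pp_f_rho_0_poly, deg2_A_recertD_quot_D1_pp_f_rho_1_poly, deg2_A_recertD_quot_D1_pp_f_rho_2_poly, deg2_A_recertD_quot_D1_pp_f_xi_01_poly, deg2_A_recertD_quot_D1_pp_f_xi_02_poly, deg2_A_recertD_quot_D1_pp_f_xi_12_poly, deg2_A_recertD_quot_D1_pp_f_zeta_01_poly, deg2_A_recertD_quot_D1_pp_f_zeta_02_poly, deg2_A_recertD_quot_D1_pp_f_zeta_12_poly] deg2_A_recertD_quot_D1_pp_V_poly))) = true := by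
  decide +kernel

/-- Coordinatewise form of a solution of the quotient system, in the `PolyRecast` vocabulary. [folklore] -/
theorem deg2_A_recertD_quot_D1_pp_hasDerivWithinAt_coord {z : ℝ → Fin 9 → ℝ} {t : ℝ} {s : Set ℝ}
    (hz : HasDerivWithinAt z (deg2_A_recertD_quot_D1_pp_F (z t)) s t) (i : Fin 9) :
    HasDerivWithinAt (fun τ ↦ z τ i)
      (Poly.eval (vars (List.ofFn (z t))) ([deg2_A_recertD_quot_D1_pp_f_rho_0_poly, deg2_A_recertD_quot_D1_pp_f_rho_1_poly, deg2_A_recertD_quot_D1_pp_f_rho_2_poly, deg2_A_recertD_quot_D1_pp_f_xi_01_poly, deg2_A_recertD_quot_D1_pp_f_xi_02_poly, deg2_A_recertD_quot_D1_pp_f_xi_12_poly, deg2_A_recertD_quot_D1_pp_f_zeta_01_poly, deg2_A_recertD_quot_D1_pp_f_zeta_02_poly, deg2_A_recertD_quot_D1_pp_f_zeta_12_poly].getD i [])) s t := by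
  have h := (hasDerivWithinAt_pi.1 hz) i
  fin_cases i <;> simpa [deg2_A_recertD_quot_D1_pp_F, deg2_A_recertD_quot_D1_pp_f_rho_0, deg2_A_recertD_quot_D1_pp_f_rho_1, deg2_A_recertD_quot_D1_pp_f_rho_2, deg2_A_recertD_quot_D1_pp_f_xi_01, deg2_A_recertD_quot_D1_pp_f_xi_02, deg2_A_recertD_quot_D1_pp_f_xi_12, deg2_A_recertD_quot_D1_pp_f_zeta_01, deg2_A_recertD_quot_D1_pp_f_zeta_02, deg2_A_recertD_quot_D1_pp_f_zeta_12] using h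

/-- **Chain rule**: along a curve with right derivative `F (z t)`, `V ∘ z` has derivative
`LV (z t) = Vdot(z t)` (`PolyRecast.hasDerivWithinAt_eval_of_isZero`). [folklore] -/
theorem deg2_A_recertD_quot_D1_pp_hasDerivWithinAt_Vz {z : ℝ → Fin 9 → ℝ} {t : ℝ} {s : Set ℝ}
    (hz : HasDerivWithinAt z (deg2_A_recertD_quot_D1_pp_F (z t)) s t) :
    HasDerivWithinAt (deg2_A_recertD_quot_D1_pp_Vz ∘ z) (deg2_A_recertD_quot_D1_pp_LVz (z t)) s t := by
  have h := PolyRecast.hasDerivWithinAt_eval_of_isZero (by decide) deg2_A_recertD_quot_D1_pp_Vdot_isLieDeriv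
    (deg2_A_recertD_quot_D1_pp_hasDerivWithinAt_coord hz)
  have e1 : deg2_A_recertD_quot_D1_pp_Vz ∘ z = fun τ ↦ Poly.eval (vars (List.ofFn (z τ))) deg2_A_recertD_quot_D1_pp_V_poly := by
    funext τ; simp [deg2_A_recertD_quot_D1_pp_Vz, deg2_A_recertD_quot_D1_pp_V]
  have e2 : deg2_A_recertD_quot_D1_pp_LVz (z t) = Poly.eval (vars (List.ofFn (z t))) deg2_A_recertD_quot_D1_pp_Vdot_poly := by
    simp [deg2_A_recertD_quot_D1_pp_LVz, deg2_A_recertD_quot_D1_pp_Vdot]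
  rw [e1, e2]
  exact h

/-! ### The ROA inclusion for the quotient model -/

/-- **T3′-roa (quotient coordinates)** — EXACTLY the hypothesis `hroa` of model-3's transport
`InverterDVOC.DvocNetwork.…invariants₃_tendsto_of_quotient_roa` (with `F = G̃`, see the `_F_eq_Gtilde`
lemma of this file when present). STATEMENT: for every level `0 < γ ≤ c = 26573/25000` and every curve `z` on
`[0, ∞)` (continuous, right derivative `F (z t)`) that stays in `M` for all `t ≥ 0` with `V(z 0) ≤ γ`:
`V(z t) ≤ γ` for all `t ≥ 0` and `z t → 0`. Via `Lyapunov.certificate_invariance_tendsto_univ`. No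
sentence here says a converter or a grid is stable. [folklore] -/
theorem deg2_A_recertD_quot_D1_pp_roa {γ : ℝ} (hγ0 : 0 < γ) (hγ : γ ≤ deg2_A_recertD_quot_D1_pp_level) :
    ∀ z : ℝ → Fin 9 → ℝ, ContinuousOn z (Ici 0) →
      (∀ t, 0 ≤ t → HasDerivWithinAt z (deg2_A_recertD_quot_D1_pp_F (z t)) (Ici t) t) → (∀ t, 0 ≤ t → z t ∈ deg2_A_recertD_quot_D1_pp_M) →
      deg2_A_recertD_quot_D1_pp_Vz (z 0) ≤ γ → (∀ t, 0 ≤ t → deg2_A_recertD_quot_D1_pp_Vz (z t) ≤ γ) ∧ Tendsto z atTop (𝓝 0) := by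
  intro z hzc hz hzM h0V
  have hF : Continuous deg2_A_recertD_quot_D1_pp_F := by
    refine continuous_pi fun i ↦ ?_
    fin_cases i <;> simp [deg2_A_recertD_quot_D1_pp_F, deg2_A_recertD_quot_D1_pp_f_rho_0_eq, deg2_A_recertD_quot_D1_pp_f_rho_1_eq, deg2_A_recertD_quot_D1_pp_f_rho_2_eq, deg2_A_recertD_quot_D1_pp_f_xi_01_eq, deg2_A_recertD_quot_D1_pp_f_xi_02_eq, deg2_A_recertD_quot_D1_pp_f_xi_12_eq, deg2_A_recertD_quot_D1_pp_f_zeta_01_eq, deg2_A_recertD_quot_D1_pp_f_zeta_02_eq, deg2_A_recertD_quot_D1_pp_f_zeta_12_eq] <;> fun_prop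
  have hV : Continuous deg2_A_recertD_quot_D1_pp_Vz := by unfold deg2_A_recertD_quot_D1_pp_Vz; simp only [deg2_A_recertD_quot_D1_pp_V_eq]; fun_prop
  have hW : Continuous deg2_A_recertD_quot_D1_pp_Wz := by unfold deg2_A_recertD_quot_D1_pp_Wz; fun_prop
  have h0 : (0 : Fin 9 → ℝ) ∈ deg2_A_recertD_quot_D1_pp_M := by
    refine ⟨by simp [deg2_A_recertD_quot_D1_pp_h1_eq], by simp [deg2_A_recertD_quot_D1_pp_h2_eq], by simp [deg2_A_recertD_quot_D1_pp_h3_eq], by simp [deg2_A_recertD_quot_D1_pp_h4_eq], by simp [deg2_A_recertD_quot_D1_pp_h5_eq], by simp [deg2_A_recertD_quot_D1_pp_h6_eq], by simp [deg2_A_recertD_quot_D1_pp_h7_eq], by simp [deg2_A_recertD_quot_D1_pp_h8_eq], by simp [deg2_A_recertD_quot_D1_pp_h9_eq], by norm_num, by norm_num, by norm_num⟩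
  have hMc : IsClosed deg2_A_recertD_quot_D1_pp_M := deg2_A_recertD_quot_D1_pp_isClosed_M
  have hSγ : IsCompact {y ∈ deg2_A_recertD_quot_D1_pp_M | deg2_A_recertD_quot_D1_pp_Vz y ≤ γ} :=
    deg2_A_recertD_quot_D1_pp_isCompact_S.of_isClosed_subset (hMc.inter (isClosed_le hV continuous_const))
      (fun y hy ↦ ⟨hy.1, hy.2.trans hγ⟩)
  have h := certificate_invariance_tendsto_univ (M := deg2_A_recertD_quot_D1_pp_M) (LV := deg2_A_recertD_quot_D1_pp_LVz) (W := deg2_A_recertD_quot_D1_pp_Wz)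
    (x₀ := 0) hSγ hF.continuousOn hV.continuousOn hW.continuousOn
    (fun y hy hVy ↦ deg2_A_recertD_quot_D1_pp_LVz_le hy (hVy.trans hγ))
    (fun y _ _ ↦ by simp only [deg2_A_recertD_quot_D1_pp_Wz]; positivity)
    (fun y _ hVy ↦ deg2_A_recertD_quot_D1_pp_Wz_pos hγ0 hVy)
    h0 (by simp [deg2_A_recertD_quot_D1_pp_Vz, deg2_A_recertD_quot_D1_pp_V_eq]; exact hγ0.le) (by simp [deg2_A_recertD_quot_D1_pp_Wz])
    (fun y _ _ hWy ↦ deg2_A_recertD_quot_D1_pp_eq_zero_of_Wz hWy)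
    hzc hz (fun t ht ↦ deg2_A_recertD_quot_D1_pp_hasDerivWithinAt_Vz (hz t ht)) hzM h0V
  exact ⟨fun t ht ↦ h.1 t ht, h.2⟩

/-! ### The typed model: `F = G̃`, the constraint set along network states, and the network-level sentence -/

open Summit.Ventures.GridStability.Models.InverterDVOC in
/-- **The Bench field IS model-3's shifted quotient field** `G̃` of the instance (model-4's nine lists;
kernel identity by `ring`, component by component). [folklore] -/
theorem deg2_A_recertD_quot_D1_pp_F_eq_Gtilde : deg2_A_recertD_quot_D1_pp_F = DvocNetwork.gcbd19n3d1.Gtilde := by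
  funext z
  funext i
  fin_cases i <;> simp [deg2_A_recertD_quot_D1_pp_F, deg2_A_recertD_quot_D1_pp_f_rho_0_eq, deg2_A_recertD_quot_D1_pp_f_rho_1_eq, deg2_A_recertD_quot_D1_pp_f_rho_2_eq, deg2_A_recertD_quot_D1_pp_f_xi_01_eq, deg2_A_recertD_quot_D1_pp_f_xi_02_eq, deg2_A_recertD_quot_D1_pp_f_xi_12_eq, deg2_A_recertD_quot_D1_pp_f_zeta_01_eq, deg2_A_recertD_quot_D1_pp_f_zeta_02_eq, deg2_A_recertD_quot_D1_pp_f_zeta_12_eq, DvocNetwork.gcbd19n3d1.Gtilde] <;> ring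

open Summit.Ventures.GridStability.Models.InverterDVOC in
/-- **Every network state's shifted invariant vector lies in `M`**: the nine shifted rank-one
syzygies are identities of `v̂ ↦ (‖v̂_k‖², ⟨v̂_k, v̂_j⟩, v̂_k ∧ v̂_j)` and `‖v̂_k‖² ≥ 0` (the transport's
hypothesis `hM`, discharged). [folklore] -/
theorem deg2_A_recertD_quot_D1_pp_invariants_mem_M (v : DvocNetwork.State 3) :
    DvocNetwork.invariants₃ v - DvocNetwork.gcbd19n3d1.rstar ∈ deg2_A_recertD_quot_D1_pp_M := by
  simp only [deg2_A_recertD_quot_D1_pp_M, Set.mem_setOf_eq, deg2_A_recertD_quot_D1_pp_h1_eq, deg2_A_recertD_quot_D1_pp_h2_eq, deg2_A_recertD_quot_D1_pp_h3_eq, deg2_A_recertD_quot_D1_pp_h4_eq, deg2_A_recertD_quot_D1_pp_h5_eq, deg2_A_recertD_quot_D1_pp_h6_eq, deg2_A_recertD_quot_D1_pp_h7_eq, deg2_A_recertD_quot_D1_pp_h8_eq, deg2_A_recertD_quot_D1_pp_h9_eq, Pi.sub_apply, DvocNetwork.invariants₃, DvocNetwork.gcbd19n3d1.rstar,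
    DvocNetwork.rho, DvocNetwork.xi, DvocNetwork.zeta, Matrix.cons_val_zero, Matrix.cons_val_one,
    Matrix.cons_val]
  refine ⟨by ring, by ring, by ring, by ring, by ring, by ring, by ring, by ring, by ring, ?_, ?_, ?_⟩ <;>
    nlinarith [sq_nonneg (v.1 0), sq_nonneg (v.2 0), sq_nonneg (v.1 1), sq_nonneg (v.2 1),
      sq_nonneg (v.1 2), sq_nonneg (v.2 2)]

open Summit.Ventures.GridStability.Models.InverterDVOC in
/-- **T3′ «DVOC3-GCBD19-D1q» — the network-level sentence (model-3's transport applied; no hypothesis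
left).** MODELLED: the reduced-order dVOC network `gcbd19n3d1` (model-3's three-converter instance «D1»; MODEL-VALIDITY tokens as in the Bench file). CERTIFIED
inputs: the two kernel identities of the Bench file. STATEMENT: for every `0 < γ ≤ 26573/25000` and every
solution `v̂` of the network model on `[0, ∞)` whose shifted invariant vector satisfies
`V(r(v̂ 0) − r⋆) ≤ γ`: `V(r(v̂ t) − r⋆) ≤ γ` for all `t ≥ 0` and `r(v̂ t) → r⋆` — `‖v̂_k‖² → ρ_k⋆`,
`⟨v̂_k, v̂_j⟩ → ξ_kj⋆`, `v̂_k ∧ v̂_j → ζ_kj⋆`: convergence to the rest ORBIT of the model. No sentence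
here says a converter or a grid is stable. [folklore] -/
theorem deg2_A_recertD_quot_D1_pp_network_roa {γ : ℝ} (hγ0 : 0 < γ) (hγ : γ ≤ deg2_A_recertD_quot_D1_pp_level)
    {v : ℝ → DvocNetwork.State 3} (hv : DvocNetwork.gcbd19n3d1.IsSolutionOn v (Ici 0))
    (h0 : deg2_A_recertD_quot_D1_pp_Vz (DvocNetwork.invariants₃ (v 0) - DvocNetwork.gcbd19n3d1.rstar) ≤ γ) :
    (∀ t, 0 ≤ t → deg2_A_recertD_quot_D1_pp_Vz (DvocNetwork.invariants₃ (v t) - DvocNetwork.gcbd19n3d1.rstar) ≤ γ) ∧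
      Tendsto (fun t ↦ DvocNetwork.invariants₃ (v t)) atTop (𝓝 DvocNetwork.gcbd19n3d1.rstar) :=
  DvocNetwork.gcbd19n3d1.invariants₃_tendsto_of_quotient_roa deg2_A_recertD_quot_D1_pp_invariants_mem_M
    (fun x hxc hx hxM hx0 ↦ deg2_A_recertD_quot_D1_pp_roa hγ0 hγ x hxc
      (fun t ht ↦ by rw [deg2_A_recertD_quot_D1_pp_F_eq_Gtilde]; exact hx t ht) hxM hx0) hv h0

end

end Summit.Ventures.GridStability.Bench.DVOCGCBD19
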